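import Literature.AlgebraicGeometry.HodgeTheory.HyperplaneClassLefschetzOperator
import Literature.AlgebraicGeometry.HodgeTheory.HodgeTypePullback
import Literature.AlgebraicGeometry.HodgeTheory.HodgeFiltrationModelsReductionProofs
import Literature.AlgebraicGeometry.HodgeTheory.HolomorphicBundleChernCharacterProjectiveSpace
import Literature.AlgebraicGeometry.HodgeTheory.SupportedClassesRationalProofs
import Literature.AlgebraicGeometry.HodgeTheory.ComplexConjugationHolds
import Literature.AlgebraicGeometry.Motives.VarietiesDimensionProofs
import Literature.AlgebraicGeometry.HodgeTheory.HyperplaneClassPullback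
import HarnessLib

/-!
# The hyperplane-type class is a complex multiple of a rational class (proved)

Family `hodge`, layer `Literature/AlgebraicGeometry/HodgeTheory`. The residue of the named fact
`nonempty_hardLefschetzNFold n X` after `HyperplaneClassLefschetzOperator`
(`nonempty_hardLefschetzNFold_of_fubiniStudy_rational`: it suffices that SOME positive multiple of
the hyperplane-type class `[θ] ∈ H²(X(ℂ); ℂ)` — the class of the restricted Fubini–Study form of a
projective embedding `ι : X ⟶ ℙᴺ`, read through a Hodge model `A` and a natural real de Rham family
`e`, `A^* H = e[θ] ⊗ 1` — be a RATIONAL class; in print `[θ]` is a real multiple of the integral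
class `c₁(𝒪_X(1))`, Voisin I Thm. 7.10 / §7.1.2) is discharged here UP TO A COMPLEX SCALAR, which
is all the hard Lefschetz datum needs (`HardLefschetzNFoldHolds`):

* `exists_ne_zero_smul_isRationalClass_of_pullback_eq_fubiniStudy` — **for `X` smooth projective
  with a Hodge model `A`, a closed immersion `ι : X ⟶ ℙᴺ`, a natural real de Rham family `e` and the
  class `H` with `A^* H = e[θ_ι] ⊗ 1`, there is `w ∈ ℂ`, `w ≠ 0`, with `w • H` rational.**

Proof (no integrality of Chern classes is used). (1) On `ℙᴺ` every class of `H²(ℙᴺ(ℂ); ℂ)` is a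
complex multiple of ONE rational class `r₀` (`dim H²(ℙᴺ(ℂ); ℂ) ≤ 1`, Hatcher Thm. 3.19, and the
rational classes span, `span_isRationalClass_eq_top_of_isSmoothProjective_holds`, Voisin I §7.1.1);
in particular the Fubini–Study class `c_P` of `ℙᴺ` (read through a Hodge model `B` of `ℙᴺ` whose
comparison is the complexification of a natural real family `e_P`) is `z₁ • r₀`, and
`ι^* c_P = z₁ • ι^* r₀` with `ι^* r₀` rational. (2) The restricted Fubini–Study FORM is natural:
`(ι^an)^* θ_{ℙᴺ} = θ_ι` (`HodgeModel.fubiniStudyPullbackForm_pullback_anMap`, file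
`HyperplaneClassPullback`, Voisin I §3.3.2), so in the Hodge model `A' = A.induce B` of `X` whose comparison `e''` is INDUCED from that of
`B` through the cylinder `X^an × ℝ^{2N-2n}` (`HodgeTypePullback`, Voisin I §7.3.2 functoriality)
one has `A^*(ι^* c_P) = e''[θ_ι ⊗ 1]`. (3) Two natural complex de Rham comparisons on the compact
complex manifold `X^an` differ by a scalar (`NaturalDeRhamComparisonRigidity_holds`): `e'' = r • (e ⊗ ℂ)`
on `H²_dR(X^an; ℂ)`, whence `ι^* c_P = r • H`, i.e. `r • H = z₁ • ι^* r₀`; for `dim X ≥ 1` the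
Kähler class `H` is non-zero, forcing `r ≠ 0 ≠ z₁`, and `w = r / z₁`; for `dim X = 0`,
`H²(X(ℂ); ℂ) = 0`.

Also proved here: `dim X ≤ N` for a closed immersion `X ⟶ ℙᴺ` of a smooth projective `X`
(`le_of_isClosedImmersion_projectiveSpace`, Krull dimension is monotone under closed embeddings).
No definition and no named fact is introduced (D-0026).

## References

* [VoisinHodgeI2002] C. Voisin, Hodge Theory and Complex Algebraic Geometry I (CUP 2002), §3.1.3,
  §3.3.2, §7.1.1, §7.1.2, Thm. 7.10, §7.3.2.
* [HatcherAT2002] A. Hatcher, Algebraic Topology (CUP 2002), Thm. 3.19, §3.1.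
* [SerreGAGA1956] J.-P. Serre, Géométrie algébrique et géométrie analytique, Ann. Inst. Fourier 6
  (1956), §2 n°5.
-/

noncomputable section

open scoped Manifold ContDiff
open CategoryTheory AlgebraicGeometry

namespace Literature.AlgebraicGeometry.HodgeTheory

section HodgeTheory

open Literature.AlgebraicTopology.SingularHomology Literature.Geometry.Kaehler
open Literature.NumberTheory.Transcendental
open Literature.AlgebraicGeometry.Motives (projectiveSpace ComplexPoints IsSmoothProjective)
open Literature.AlgebraicGeometry.Motives.AnalytificationKaehler (fubiniStudyPullbackForm)

variable {n : ℕ} {X : Motives.SchemeOver ℂ}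

/-! ### Dimension of a closed subvariety of `ℙᴺ` -/

/-- **`dim X ≤ N` for a closed immersion `X ⟶ ℙᴺ_ℂ` of a smooth projective `X` of dimension `n`**
(the topological Krull dimension is monotone along the closed embedding `X ↪ ℙᴺ`, and equals `n`,
resp. `N`, for the smooth `X`, resp. `ℙᴺ`: Görtz–Wedhorn I Lemma 5.7 (4) and 6.26, the tree's
`topologicalKrullDim_eq_of_smoothOfRelativeDimension`). [cite: Hartshorne1977, I Prop. 1.10 and II Ex. 3.20] -/
theorem le_of_isClosedImmersion_projectiveSpace (hX : IsSmoothProjective n X) {N : ℕ}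
    (ι : X ⟶ projectiveSpace N ℂ) [IsClosedImmersion ι.left] : n ≤ N := by
  have hP : IsSmoothProjective N (projectiveSpace N ℂ) := isSmoothProjective_projectiveSpace' N
  haveI := hX.smoothOfRelativeDimension
  haveI := hP.smoothOfRelativeDimension
  haveI := hX.geometricallyIrreducible
  haveI := hP.geometricallyIrreducible
  haveI : IrreducibleSpace X.left := GeometricallyIrreducible.irreducibleSpace_of_subsingleton X.hom
  haveI : IrreducibleSpace (projectiveSpace N ℂ).left :=
    GeometricallyIrreducible.irreducibleSpace_of_subsingleton (projectiveSpace N ℂ).hom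
  have h1 : topologicalKrullDim X.left = n :=
    Motives.topologicalKrullDim_eq_of_smoothOfRelativeDimension X.hom n
  have h2 : topologicalKrullDim (projectiveSpace N ℂ).left = N :=
    Motives.topologicalKrullDim_eq_of_smoothOfRelativeDimension (projectiveSpace N ℂ).hom N
  have h3 : topologicalKrullDim X.left ≤ topologicalKrullDim (projectiveSpace N ℂ).left :=
    ι.left.isClosedEmbedding.isInducing.topologicalKrullDim_le
  rw [h1, h2] at h3
  exact_mod_cast h3

/-! ### `H²(ℙᴺ(ℂ); ℂ)` is the line spanned by a rational class -/

/-- **Every class of `H²(ℙᴺ_ℂ(ℂ); ℂ)` is a complex multiple of one rational class** (`dim ≤ 1`,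
Hatcher Thm. 3.19, and the rational classes span, Voisin I §7.1.1; for `N = 0` the group vanishes
and the class `0` serves). [cite: HatcherAT2002, Thm. 3.19] [cite: VoisinHodgeI2002, §7.1.1] -/
theorem exists_isRationalClass_forall_eq_smul_projectiveSpace (N : ℕ) :
    ∃ r₀ : complexBetti (projectiveSpace N ℂ) 2, IsRationalClass r₀ ∧
      ∀ c : complexBetti (projectiveSpace N ℂ) 2, ∃ z : ℂ, c = z • r₀ := by
  have hP : IsSmoothProjective N (projectiveSpace N ℂ) := isSmoothProjective_projectiveSpace' N
  rcases Nat.eq_zero_or_pos N with rfl | hN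
  · haveI : Subsingleton (complexBetti (projectiveSpace 0 ℂ) 2) :=
      Motives.ComplexPoints.subsingleton_singularCohomology_of_lt hP ℂ (k := 2) (by omega)
    exact ⟨0, IsRationalClass.zero, fun c ↦ ⟨0, Subsingleton.elim _ _⟩⟩
  · have h1 : Module.finrank ℂ (complexBetti (projectiveSpace N ℂ) 2) = 1 :=
      finrank_complexBetti_projectiveSpace_two_mul_eq_one N (p := 1) hN
    haveI : Module.Finite ℂ (complexBetti (projectiveSpace N ℂ) 2) := Module.finite_of_finrank_eq_succ h1
    -- a non-zero rational class exists (the rational classes span a non-zero space)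
    have hspan := span_isRationalClass_eq_top_of_isSmoothProjective_holds N (projectiveSpace N ℂ) hP 2
    obtain ⟨r₀, hr₀, hr₀0⟩ : ∃ r₀ : complexBetti (projectiveSpace N ℂ) 2, IsRationalClass r₀ ∧ r₀ ≠ 0 := by
      by_contra hcon
      have hbot : Submodule.span ℂ {c : complexBetti (projectiveSpace N ℂ) 2 | IsRationalClass c} = ⊥ :=
        Submodule.span_eq_bot.2 fun c hc ↦ by_contra fun h0 ↦ hcon ⟨c, hc, h0⟩
      rw [hspan] at hbot
      haveI : Subsingleton (complexBetti (projectiveSpace N ℂ) 2) :=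
        subsingleton_of_forall_eq 0 fun c ↦ (Submodule.mem_bot ℂ).1 (hbot ▸ Submodule.mem_top)
      rw [Module.finrank_zero_of_subsingleton] at h1
      exact zero_ne_one h1
    refine ⟨r₀, hr₀, fun c ↦ ?_⟩
    obtain ⟨z, hz⟩ := (finrank_eq_one_iff_of_nonzero' r₀ hr₀0).1 h1 c
    exact ⟨z, hz.symm⟩

/-! ### The hyperplane-type class is a complex multiple of a rational class -/

/-- `X^an` is compact for `X` smooth projective (`X` proper, `X(ℂ)` compact, `X^an ≃ₜ X(ℂ)`). Local
copy of `HodgeModel.compactSpace_carrier` (file `HypersurfaceHolomorphicForms`, not imported).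
[cite: SerreGAGA1956, §2 n°7 Prop. 6] -/
private theorem compactSpace_carrier₀ (A : HodgeModel n X) (hX : IsSmoothProjective n X) :
    CompactSpace A.carrier := by
  haveI : IsProper X.hom := Motives.IsSmoothProjective.isProper_holds hX
  haveI : CompactSpace (ComplexPoints X) := Motives.compactSpace_algPoints_of_isProper_holds X ℂ
  exact A.isAnalytification.homeomorph.symm.compactSpace

/-- **The hyperplane-type class is a non-zero complex multiple of a rational class.** For `X`
smooth projective of dimension `n` with a Hodge model `A`, a closed immersion `ι : X ⟶ ℙᴺ`, a
NATURAL real de Rham family `e` over the `A.model`-manifolds and the class `H ∈ H²(X(ℂ); ℂ)` with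
`A^* H = e[θ_ι] ⊗ 1` (`θ_ι` the restricted Fubini–Study form): some `w • H`, `w ∈ ℂ ∖ {0}`, is a
rational class. (In print `[θ_ι]` is a real multiple of `c₁(𝒪_X(1)) ∈ H²(X, ℤ)`, Voisin I Thm. 7.10;
here: `H²(ℙᴺ(ℂ); ℂ) = ℂ · r₀` with `r₀` rational, `(ι^an)^*θ_{ℙᴺ} = θ_ι`, functoriality of the
induced comparison and rigidity of natural comparisons — module docstring.)
[cite: VoisinHodgeI2002, Thm. 7.10, §7.1.2 and §7.3.2] [cite: HatcherAT2002, Thm. 3.19] -/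
theorem exists_ne_zero_smul_isRationalClass_of_pullback_eq_fubiniStudy (hX : IsSmoothProjective n X)
    (A : HodgeModel n X) {N : ℕ} (ι : X ⟶ projectiveSpace N ℂ) [IsClosedImmersion ι.left]
    (e : DeRhamIsoFamily 𝓘(ℝ, A.model)) (he : e.IsNatural)
    (hθ : fubiniStudyPullbackForm A.model ι A.toComplexPoints ∈ closedSmoothForms 𝓘(ℝ, A.model) A.carrier ℝ 2)
    {H : complexBetti X 2}
    (hH : A.pullback 2 H = ofRealClass A.carrier 2 (e A.carrier 2
      (deRhamCohomology.mk ⟨fubiniStudyPullbackForm A.model ι A.toComplexPoints, hθ⟩))) :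
    ∃ w : ℂ, w ≠ 0 ∧ IsRationalClass (w • H) := by
  -- dimension `0`: `H²(X(ℂ); ℂ) = 0`
  rcases Nat.eq_zero_or_pos n with rfl | hn
  · haveI : Subsingleton (complexBetti X 2) :=
      Motives.ComplexPoints.subsingleton_singularCohomology_of_lt hX ℂ (k := 2) (by omega)
    refine ⟨1, one_ne_zero, ?_⟩
    rw [Subsingleton.elim (1 • H : complexBetti X 2) 0]
    exact IsRationalClass.zero
  -- the projective space, a Hodge model `B` of it with comparison `e_P ⊗ ℂ`
  have hP : IsSmoothProjective N (projectiveSpace N ℂ) := isSmoothProjective_projectiveSpace' N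
  have hnN : n ≤ N := le_of_isClosedImmersion_projectiveSpace hX ι
  obtain ⟨B₀⟩ := (nonempty_hodgeModel_holds (n := N) (X := projectiveSpace N ℂ)).nonempty hP
  obtain ⟨eP, heP, -, -⟩ := exists_deRhamIsoFamily_holds B₀.model
  let B : HodgeModel N (projectiveSpace N ℂ) :=
    { B₀ with
      deRham := eP.complexify
      deRham_isNatural := DeRhamIsoFamily.complexify_isNatural heP }
  -- the Fubini–Study class `c_P` of `ℙᴺ`
  haveI : IsClosedImmersion (𝟙 (projectiveSpace N ℂ) : projectiveSpace N ℂ ⟶ projectiveSpace N ℂ).left :=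
    show IsClosedImmersion (𝟙 (projectiveSpace N ℂ).left) from inferInstance
  have hθP := B.fubiniStudyPullbackForm_mem_closedSmoothForms (𝟙 (projectiveSpace N ℂ))
  obtain ⟨cP, hcP⟩ := B.pullback_surjective 2 (ofRealClass B.carrier 2 (eP B.carrier 2
    (deRhamCohomology.mk ⟨fubiniStudyPullbackForm B.model (𝟙 (projectiveSpace N ℂ)) B.toComplexPoints, hθP⟩)))
  -- (1) `c_P = z₁ • r₀`, `r₀` rational; `ι^* c_P = z₁ • ι^* r₀`
  obtain ⟨r₀, hr₀, hgen⟩ := exists_isRationalClass_forall_eq_smul_projectiveSpace N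
  obtain ⟨z₁, hz₁⟩ := hgen cP
  set H₁ : complexBetti X 2 :=
    singularCohomology.map ℂ ℂ (Motives.AlgPoints.mapContinuous (L := ℂ) ι) 2 cP with hH₁def
  have hH₁ : H₁ = z₁ • singularCohomology.map ℂ ℂ (Motives.AlgPoints.mapContinuous (L := ℂ) ι) 2 r₀ := by
    rw [hH₁def, hz₁, map_smul]
  have hR : IsRationalClass (singularCohomology.map ℂ ℂ (Motives.AlgPoints.mapContinuous (L := ℂ) ι) 2 r₀) :=
    hr₀.pullback _
  -- (2) in the induced model: `A^* H₁ = e''[(ι^an)^* θ_P ⊗ 1]`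
  have hfan : ContMDiff 𝓘(ℝ, A.model) 𝓘(ℝ, B.model) ∞ (HodgeModel.anMap B A ι) :=
    HodgeModel.contMDiff_anMap B A ι hX hP
  set wP : complexDeRhamCohomology B.model B.carrier 2 := complexDeRhamCohomology.ofReal B.model B.carrier 2
    (deRhamCohomology.mk ⟨fubiniStudyPullbackForm B.model (𝟙 (projectiveSpace N ℂ)) B.toComplexPoints, hθP⟩) with hwPdef
  have hwc : B.pullback 2 cP = B.deRham B.carrier 2 wP := by
    rw [hcP, hwPdef]
    exact (complexifyFun_ofReal eP 2 _).symm
  have key : A.pullback 2 H₁ =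
      HodgeModel.inducedIso B A hnN A.carrier 2 (complexDeRhamCohomology.map A.model hfan 2 wP) := by
    rw [HodgeModel.inducedIso_apply, ← LinearMap.comp_apply
        (g := complexDeRhamCohomology.map A.model hfan 2),
      ← complexDeRhamCohomology.map_comp hfan (contMDiff_cylFst B A hnN A.carrier),
      B.deRham_isNatural (Cyl B A hnN A.carrier) B.carrier _
        (hfan.comp (contMDiff_cylFst B A hnN A.carrier)) 2 wP,
      ← hwc, ← HodgeModel.map_anMap_pullback]
    change _ = ((singularCohomology.map ℂ ℂ _ 2 ≫ singularCohomology.map ℂ ℂ _ 2).hom _)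
    rw [← singularCohomology.map_comp]
    rfl
  -- the pulled-back form is `θ_ι`
  have hpull : (fubiniStudyPullbackForm B.model (𝟙 (projectiveSpace N ℂ)) B.toComplexPoints).pullback
      𝓘(ℝ, A.model) (HodgeModel.anMap B A ι) = fubiniStudyPullbackForm A.model ι A.toComplexPoints := by
    have h := A.fubiniStudyPullbackForm_pullback_anMap B ι (𝟙 (projectiveSpace N ℂ)) hX hP
    rwa [Category.comp_id] at h
  have hmap : complexDeRhamCohomology.map A.model hfan 2 wP =
      complexDeRhamCohomology.ofReal A.model A.carrier 2
        (deRhamCohomology.mk ⟨fubiniStudyPullbackForm A.model ι A.toComplexPoints, hθ⟩) := by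
    haveI : PullbackFacts 𝓘(ℝ, A.model) A.carrier 𝓘(ℝ, B.model) B.carrier ℝ := PullbackFacts.real_of_complex
    rw [hwPdef, ← complexDeRhamCohomology.ofReal_map, deRhamCohomology.map_mk]
    congr 2
    exact Subtype.ext hpull
  -- (3) rigidity: `e'' = r • (e ⊗ ℂ)` on `H²_dR(X^an; ℂ)`
  haveI : CompactSpace A.carrier := compactSpace_carrier₀ A hX
  obtain ⟨r, hr⟩ := NaturalDeRhamComparisonRigidity_holds A.model A.model (HodgeModel.inducedFamily B A hnN)
    (HodgeModel.isNatural_inducedFamily B A hnN) e.complexify (DeRhamIsoFamily.complexify_isNatural he)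
    A.carrier A.carrier (Homeomorph.refl A.carrier) contMDiff_id contMDiff_id 2
  have hr' : ∀ y : complexDeRhamCohomology A.model A.carrier 2,
      e.complexify A.carrier 2 y = r • HodgeModel.inducedIso B A hnN A.carrier 2 y := by
    intro y
    have h := hr y
    have h1 : (⟨Homeomorph.refl A.carrier, (Homeomorph.refl A.carrier).continuous⟩ : C(A.carrier, A.carrier)) =
        ContinuousMap.id A.carrier := rfl
    have h2 : complexDeRhamCohomology.map A.model
        (contMDiff_id : ContMDiff 𝓘(ℝ, A.model) 𝓘(ℝ, A.model) ∞ (Homeomorph.refl A.carrier)) 2 =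
          LinearMap.id :=
      complexDeRhamCohomology.map_id (E := A.model) (M := A.carrier) 2
    have lhs : singularCohomology.map ℂ ℂ
        (⟨Homeomorph.refl A.carrier, (Homeomorph.refl A.carrier).continuous⟩ : C(A.carrier, A.carrier)) 2
          (e.complexify A.carrier 2 y) = e.complexify A.carrier 2 y := by
      rw [h1, singularCohomology.map_id]
      rfl
    have rhs : HodgeModel.inducedFamily B A hnN A.carrier 2 (complexDeRhamCohomology.map A.model
        (contMDiff_id : ContMDiff 𝓘(ℝ, A.model) 𝓘(ℝ, A.model) ∞ (Homeomorph.refl A.carrier)) 2 y) =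
          HodgeModel.inducedIso B A hnN A.carrier 2 y :=
      congrArg (HodgeModel.inducedIso B A hnN A.carrier 2) (LinearMap.congr_fun h2 y)
    exact lhs.symm.trans (h.trans (congrArg (r • ·) rhs))
  -- `e ⊗ ℂ` of `θ_ι ⊗ 1` is `A^* H`
  have hHc : A.pullback 2 H = e.complexify A.carrier 2 (complexDeRhamCohomology.ofReal A.model A.carrier 2
      (deRhamCohomology.mk ⟨fubiniStudyPullbackForm A.model ι A.toComplexPoints, hθ⟩)) := by
    rw [hH]
    exact (complexifyFun_ofReal e 2 _).symm
  -- hence `A^* H = r • A^* H₁`, `H = r • H₁ = (r z₁) • ι^* r₀`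
  have hHH₁ : H = r • H₁ := by
    apply A.pullback_injective 2
    rw [map_smul, key, hmap, hHc, hr']
  -- `H ≠ 0` (a Kähler class), so `r ≠ 0` and `z₁ ≠ 0`
  have hK : A.IsKaehlerClassVia e H := A.isKaehlerClassVia_of_pullback_eq_fubiniStudyPullbackForm e hX ι hθ hH
  have hH0 : H ≠ 0 := hK.ne_zero hX hn
  have hr0 : r ≠ 0 := by
    rintro rfl
    exact hH0 (by rw [hHH₁, zero_smul])
  have hz0 : z₁ ≠ 0 := by
    rintro rfl
    exact hH0 (by rw [hHH₁, hH₁, zero_smul, smul_zero])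
  refine ⟨(r * z₁)⁻¹, inv_ne_zero (mul_ne_zero hr0 hz0), ?_⟩
  rw [hHH₁, hH₁, smul_smul, smul_smul, mul_assoc, inv_mul_cancel₀ (mul_ne_zero hr0 hz0), one_smul]
  exact hR

end HodgeTheory

end Literature.AlgebraicGeometry.HodgeTheory

end
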